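import Summits.AtomisticToContinuum.Crystallization.Theorems.PalmUnimodularRigidityMinimiserShellsSlackCertificates

/-!
# The defect transport of line `octahedral-annulus-mandate`: joint measurability and mass SENT
(crux `MinimiserShells`, stmt-AtomisticToContinuum-9225; registered stub `stub_defectTransportSent` of the
checked skeleton `Cruxes/MinimiserShells/Lines/octahedral_annulus_mandate.lean`, reshape r3)

Route `PalmUnimodularRigidity`, crux decl
`Summit.AtomisticToContinuum.Crystallization.Theses.PalmUnimodularRigidity.MinimiserShells`.

Next to the random-grid transport of item 9229 (`EnergyFloor.transport δ L`: the root sends the share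
`(local energy + C_δ)/#cell` to every point of its cell `rootCell L v`, phase-averaged over `v ∈ [0,1)³`),
the SUFFICIENCY half of the reshaped stub `stub_capCertificates` runs a second, non-negative DEFECT
TRANSPORT: for a measurable event `B` of configurations, a surcharge `c`, a class parameter `δ` and a
mesh `L`,

`dT(μ, y) = ∫_{v ∈ [0,1)³} 1[y ∈ rootCell L v] · c·1[((trunc δ μ)|rootCell L v − y) ∉ B] / (trunc δ μ)(rootCell L v) dv`

— the root sends `c/#cell` to every cell-mate `y` whose cell cluster, RE-ROOTED at `y`, lies outside `B`
(through the truncation `trunc δ` of `…EnergyFloorDefs`, so that it is defined and measurable for every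
measure).

**Theorem** (`stub_defectTransportSent`).
* `dT` is jointly measurable in `(μ, y)` (`measurable_defectTransport`): the new ingredient over
  `EnergyFloor.measurable_transport` is the Giry-measurability of the parametrised re-rooted cell cluster
  `(μ, v, w) ↦ ((trunc δ μ)|rootCell L v).map (· − w)` (`measurable_map_sub_restrict_trunc`, from
  `EnergyFloor.measurable_trunc_apply` on the set `{((v, w), z) | z − w ∈ A, z ∈ rootCell L v}`), after
  which `Measurable.lintegral_prod_right'` integrates out the phase.
* On a rooted `δ`-hard-core configuration `μ` the total mass SENT is the phase average of
  `(∑_{y ∈ rootCell L v} c·1[(μ|rootCell L v − y) ∉ B]) / #cell` (`lintegral_defectTransport_eq`: Tonelli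
  for `count|S`, `EnergyFloor.lintegral_count_restrict_setLIntegral_comm`, then `trunc_of_mem` and the
  constant denominator pulled out of the cell sum).
-/

noncomputable section

open MeasureTheory Filter Set
open scoped ENNReal BigOperators Topology

namespace Summit.AtomisticToContinuum.Crystallization.Theorems.PalmUnimodularRigidityMinimiserShells.DefectTransportSent

open Literature.Probability.Process (IsRootedHardCore count_restrict_singleton_ne_zero_iff map_sub_count_restrict)
open Summit.AtomisticToContinuum.Crystallization.Theorems.MinimiserShells.Negative.Rootedness (E3 countable_of_separated)
open Summit.AtomisticToContinuum.Crystallization.Theorems.PalmUnimodularRigidityMinimiserShells.EnergyFloor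

/-! ## Measurability of the parametrised re-rooted cell cluster -/

/-- For a measurable `A ⊆ ℝ³`, `((μ, v), w) ↦ (trunc δ μ) ((· − w) ⁻¹' A ∩ rootCell L v)` is jointly
measurable (an instance of `EnergyFloor.measurable_trunc_apply`). -/
theorem measurable_trunc_preimage_inter_rootCell (δ L : ℝ) {A : Set E3} (hA : MeasurableSet A) :
    Measurable fun p : (Measure E3 × E3) × E3 =>
      trunc δ p.1.1 ((fun z => z - p.2) ⁻¹' A ∩ rootCell L p.1.2) := by
  have hs : MeasurableSet {q : (E3 × E3) × E3 |
      q.2 - q.1.2 ∈ A ∧ cellIdx L q.1.1 q.2 = cellIdx L q.1.1 0} :=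
    (hA.preimage (measurable_snd.sub measurable_fst.snd)).inter
      ((measurableSet_cellIdx_eq L 0).preimage (measurable_fst.fst.prodMk measurable_snd))
  exact (measurable_trunc_apply (δ := δ) hs).comp
    (measurable_fst.fst.prodMk (measurable_fst.snd.prodMk measurable_snd))

/-- **The parametrised re-rooted cell cluster is Giry-measurable**:
`((μ, v), w) ↦ ((trunc δ μ)|rootCell L v).map (· − w)` is a measurable map into `Measure ℝ³`. -/
theorem measurable_map_sub_restrict_trunc (δ L : ℝ) :
    Measurable fun p : (Measure E3 × E3) × E3 =>
      ((trunc δ p.1.1).restrict (rootCell L p.1.2)).map (fun z => z - p.2) := by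
  refine Measure.measurable_of_measurable_coe _ fun A hA => ?_
  convert measurable_trunc_preimage_inter_rootCell δ L hA using 1
  funext p
  rw [Measure.map_apply (measurable_sub_const p.2) hA,
    Measure.restrict_apply (hA.preimage (measurable_sub_const p.2))]

/-- At a fixed configuration and phase, the re-rooted cell cluster is measurable in the new root. -/
theorem measurable_map_sub_restrict (δ L : ℝ) (μ : Measure E3) (v : E3) :
    Measurable fun w : E3 => ((trunc δ μ).restrict (rootCell L v)).map (fun z => z - w) :=
  (measurable_map_sub_restrict_trunc δ L).comp (measurable_prodMk_left (x := (μ, v)))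

/-! ## Measurability of the defect transport -/

section Transport

variable {B : Set (Measure E3)}

/-- The surcharge density `((μ, v), w) ↦ c·1[((trunc δ μ)|rootCell L v − w) ∉ B] / (trunc δ μ)(rootCell L v)`
is jointly measurable. -/
theorem measurable_surcharge (hB : MeasurableSet B) (c δ L : ℝ) :
    Measurable fun p : (Measure E3 × E3) × E3 =>
      Bᶜ.indicator (fun _ => ENNReal.ofReal c)
          (((trunc δ p.1.1).restrict (rootCell L p.1.2)).map (fun z => z - p.2)) /
        trunc δ p.1.1 (rootCell L p.1.2) :=
  ((measurable_const.indicator hB.compl).comp (measurable_map_sub_restrict_trunc δ L)).div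
    ((measurable_trunc_rootCell δ L).comp measurable_fst)

/-- The defect-transport integrand, in the variables `((μ, v), y)`, is jointly measurable. -/
theorem measurable_defect_integrand' (hB : MeasurableSet B) (c δ L : ℝ) :
    Measurable fun q : (Measure E3 × E3) × E3 =>
      (rootCell L q.1.2).indicator (fun w => Bᶜ.indicator (fun _ => ENNReal.ofReal c)
        (((trunc δ q.1.1).restrict (rootCell L q.1.2)).map (fun z => z - w)) /
          trunc δ q.1.1 (rootCell L q.1.2)) q.2 :=
  measurable_indicator_param (s := fun a : Measure E3 × E3 => rootCell L a.2)
    ((measurableSet_cellIdx_eq L 0).preimage (measurable_fst.snd.prodMk measurable_snd))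
    (measurable_surcharge hB c δ L)

/-- The defect-transport integrand `((μ, y), v) ↦ 1[y ∈ rootCell L v] · (surcharge density)` is jointly
measurable. -/
theorem measurable_defect_integrand (hB : MeasurableSet B) (c δ L : ℝ) :
    Measurable fun q : (Measure E3 × E3) × E3 =>
      (rootCell L q.2).indicator (fun w => Bᶜ.indicator (fun _ => ENNReal.ofReal c)
        (((trunc δ q.1.1).restrict (rootCell L q.2)).map (fun z => z - w)) /
          trunc δ q.1.1 (rootCell L q.2)) q.1.2 :=
  (measurable_defect_integrand' hB c δ L).comp
    ((measurable_fst.fst.prodMk measurable_snd).prodMk measurable_fst.snd)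

/-- **The defect transport is jointly measurable** in `(μ, y)` (so the Mecke identity applies to it). -/
theorem measurable_defectTransport (hB : MeasurableSet B) (c δ L : ℝ) :
    Measurable (Function.uncurry fun (μ : Measure E3) (y : E3) =>
      ∫⁻ v in phaseDom, (rootCell L v).indicator (fun w => Bᶜ.indicator (fun _ => ENNReal.ofReal c)
        (((trunc δ μ).restrict (rootCell L v)).map (fun z => z - w)) / trunc δ μ (rootCell L v)) y) :=
  (measurable_defect_integrand hB c δ L).lintegral_prod_right'

/-- For a fixed configuration and point, the defect-transport integrand is measurable in the phase. -/
theorem measurable_defect_integrand_phase (hB : MeasurableSet B) (c δ L : ℝ) (μ : Measure E3) (y : E3) :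
    Measurable fun v : E3 =>
      (rootCell L v).indicator (fun w => Bᶜ.indicator (fun _ => ENNReal.ofReal c)
        (((trunc δ μ).restrict (rootCell L v)).map (fun z => z - w)) / trunc δ μ (rootCell L v)) y :=
  (measurable_defect_integrand hB c δ L).comp (measurable_prodMk_left (x := (μ, y)))

/-! ## Mass sent out of the root -/

/-- **SENT**: on a rooted `δ`-hard-core configuration `μ` the total defect mass sent out of the root is the
phase average of `(∑_{y ∈ rootCell L v} c·1[(μ|rootCell L v − y) ∉ B]) / μ(rootCell L v)` (the truncation
does nothing on the class, the cell sum and the phase integral commute, and the denominator is constant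
along the cell). -/
theorem lintegral_defectTransport_eq (hB : MeasurableSet B) (c : ℝ) {δ L : ℝ} (hδ : 0 < δ) (hL : 0 < L)
    {μ : Measure E3} (hμ : IsRootedHardCore δ μ) :
    ∫⁻ y, (∫⁻ v in phaseDom, (rootCell L v).indicator (fun w => Bᶜ.indicator (fun _ => ENNReal.ofReal c)
      (((trunc δ μ).restrict (rootCell L v)).map (fun z => z - w)) / trunc δ μ (rootCell L v)) y) ∂μ =
    ∫⁻ v in phaseDom, (∫⁻ y in rootCell L v, Bᶜ.indicator (fun _ => ENNReal.ofReal c)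
      ((μ.restrict (rootCell L v)).map (fun z => z - y)) ∂μ) / μ (rootCell L v) := by
  have hμ' := hμ
  have hmem := mem_hcClass_of_hc hδ hμ
  obtain ⟨S, -, hsep, rfl⟩ := hμ
  have hS := countable_of_separated hδ hsep
  refine (lintegral_count_restrict_setLIntegral_comm hS
    (fun y => measurable_defect_integrand_phase hB c δ L _ y) phaseDom).trans ?_
  refine lintegral_congr fun v => ?_
  obtain ⟨hn0, -⟩ := trunc_rootCell_ne_zero_ne_top hδ hL hμ' v
  rw [trunc_of_mem hmem] at hn0 ⊢
  rw [lintegral_indicator (measurableSet_rootCell L v)]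
  simp only [div_eq_mul_inv]
  exact lintegral_mul_const' _ _ (ENNReal.inv_ne_top.2 hn0)

end Transport

/-- **STUB 1c — the defect transport: joint measurability and mass SENT** (registered stub
`stub_defectTransportSent` of line `octahedral-annulus-mandate`, verbatim).  For a measurable event `B`,
surcharge `c`, class `δ > 0` and mesh `L > 0`, the DEFECT TRANSPORT
`dT(μ, y) = ∫_{[0,1)³} 1[y ∈ C_v] · c·1[(μ|C_v re-rooted at y) ∉ B] / μ(C_v) dv` (`C_v = rootCell L v`, through
`trunc δ`) is jointly measurable in `(μ, y)`, and on a rooted `δ`-hard-core configuration its total SENT mass is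
the phase average of `c·#{cell-mates y with (μ|C_v − y) ∉ B}/#cell`. -/
theorem stub_defectTransportSent :
    ∀ B : Set (Measure E3), MeasurableSet B → ∀ c δ L : ℝ, 0 < δ → 0 < L →
      Measurable (Function.uncurry fun (μ : Measure E3) (y : E3) =>
        ∫⁻ v in phaseDom, (rootCell L v).indicator (fun w => Bᶜ.indicator (fun _ => ENNReal.ofReal c)
          (((trunc δ μ).restrict (rootCell L v)).map (fun z => z - w)) / trunc δ μ (rootCell L v)) y) ∧
      ∀ μ : Measure E3, IsRootedHardCore δ μ →
        ∫⁻ y, (∫⁻ v in phaseDom, (rootCell L v).indicator (fun w => Bᶜ.indicator (fun _ => ENNReal.ofReal c)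
          (((trunc δ μ).restrict (rootCell L v)).map (fun z => z - w)) / trunc δ μ (rootCell L v)) y) ∂μ =
        ∫⁻ v in phaseDom, (∫⁻ y in rootCell L v, Bᶜ.indicator (fun _ => ENNReal.ofReal c)
          ((μ.restrict (rootCell L v)).map (fun z => z - y)) ∂μ) / μ (rootCell L v) :=
  fun _ hB c _ _ hδ hL =>
    ⟨measurable_defectTransport hB c _ _, fun _ hμ => lintegral_defectTransport_eq hB c hδ hL hμ⟩

end Summit.AtomisticToContinuum.Crystallization.Theorems.PalmUnimodularRigidityMinimiserShells.DefectTransportSent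

end
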